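import Summits.RiemannHypothesis.RiemannHypothesis.Theses.NymanBeurling
import Summits.RiemannHypothesis.RiemannHypothesis.Theses.Strip
import Summits.RiemannHypothesis.RiemannHypothesis.Theorems.NymanBeurlingNbThesis
import Literature.NumberTheory.LFunctions.GeneralizedRH

/-!
# Line `NbLineBelowOne` for crux `NbThesis` (stmt-RiemannHypothesis-0392):
the ladder-down rung "Báez-Duarte approximation on some line `Re s = σ < 1`" and its skeleton

Forward generator G4 (ladder-down), harvested from unit `fwd-ladder-RiemannHypothesis-0392`
(typed family `NbLine σ`, `Sketch.lean` rc 0; ladder `LADDER-NbThesis.md`, evidence on the item).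

The crux `NbThesis` (Báez-Duarte distances `d_N → 0` on the critical line) is summit-strength:
`Theorems.nbThesis_iff : NbThesis ↔ Summit.RiemannHypothesis` (landed). Its own σ-LADDER is the
family `NbLine σ` — the same weighted `L²` approximation of `1` by `ζ(s)·A(s)`, `A` a Dirichlet
polynomial, on the line `Re s = σ` with the pole-killing Cauchy weight `|s-1|²/|s|⁴`:

* TOP `σ = 1/2`: `NbLine (1/2) ↔ NbThesis` (`nbLine_half_iff`, proved: on the critical line the
  weight is `1/(1/4+t²)` pointwise), hence `↔ Summit.RiemannHypothesis`
  (`nbLine_half_iff_riemannHypothesis`).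
* FLOOR `σ ≥ 1`: `σ > 1` is PROVED IN TREE, sorry-free, in the companion witness file
  `Lines/NbLineBelowOne_special.lean` (`Special.nbLine_of_one_lt : 1 < σ → NbLine σ`, natural
  approximant `Σ_{n≤N} μ(n) n^{-s}`, `ζ·L(μ) = 1`, tail of `Σ n^{-σ}`, weight `≤ (1+t²)⁻¹`);
  `σ = 1` is PROVED IN PRINT — Théorème NBBF at `p = 1` (Bercovici–Foias 1984, Thm 2.5, as stated
  in Balazard–Saias 1998, p. 311) read through Mellin–Plancherel (for the natural Möbius
  approximation, arXiv:2606.16097 Thm 3.1 gives `σ > 1`); `σ = 1` is not yet a tree theorem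
  (PNT-level input).
* RUNG filed here: `NbLineBelowOne : ∃ σ < 1, NbLine σ` — ONE parameter (the abscissa) moved from
  the proved floor `σ ≥ 1` into the open regime `σ < 1`, in the direction of the top `σ = 1/2`.
  For `1/2 ≤ σ < 1`, `NbLine σ` carries exactly the information "ζ ≠ 0 on `Re s > σ`"
  (Beurling–Lax / Hardy-space dictionary; arXiv:2606.16097 Prop 3.1 for the easy half), so the rung
  is EQUIVALENT IN PRINT to route Strip's crux #2 `Strip.StripZeroFreeStrip` (stmt-RiemannHypothesis-10660,
  a zero-free vertical strip): disposition FRONTIER, shared arithmetic input declared verbatim below.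

SKELETON (two registered stubs, composition kernel-checked):
* `stub_zeroFreeStrip : ZeroFreeStrip` — `∃ δ > 0`, no zero of `ζ` with `1 - δ < Re s < 1`;
  VERBATIM `Strip.StripZeroFreeStrip` (`zeroFreeStrip_iff_strip : _ ↔ _ := Iff.rfl`), i.e.
  `∃ δ > 0, QuasiRiemannHypothesis (1 - δ)` (`zeroFreeStrip_iff_quasiRH`).  SHARED with route Strip
  (staffed there); the open arithmetic input (open since 1896, RH-implied).
* `stub_deepHalfAtAbscissa : DeepHalfAtAbscissa` — the TRANSFER: quasi-RH(`θ`) gives the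
  Báez-Duarte approximation on every line `Re s = σ`, `θ < σ < 1`.  Unconditional implication,
  provable by the tree's own critical-line architecture WITHOUT the `δ`-shift / `T₁` term
  (`Literature.NumberTheory.LFunctions.RHClassicalEquivalentsProofs`): take `A = ` Riesz means
  `M_n(s) = Σ_{a≤n} μ(a)(1-a/n)² a^{-s}` at `s` itself; `1 - ζ M_n = ζ (ζ⁻¹ - M_n)` on the line
  (`ζ ≠ 0` there under quasi-RH(`θ`)); `‖ζ⁻¹ - M_n‖ ≤ C n^{-κ} (1+|t|)^ε` by Perron for the Riesz
  kernel shifted to `Re = θ' ∈ (θ, σ)` using the IN-TREE quasi-RH bound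
  `MertensBoundQuasiRH.exists_bound_zetaInv` (θ-version of `RieszPerron.perronIntegral_shift` /
  `norm_rieszSum_sub_inv_riemannZeta_le`); `‖ζ(σ+it)‖ ≤ C (1+|t|)^ε` from
  `InvZetaQuasiRH.exists_log_riemannZeta` / `norm_log_le_rpow`; then the weighted `L²` assembly of
  `exists_lintegral_T2_lt`.  Size L (formalisation, no new mathematics).
* Composition `nbLineBelowOne_of_stubs : ZeroFreeStrip → DeepHalfAtAbscissa → ∃ σ < 1, NbLine σ`
  (the unfolded rung) PROVED (`θ := max (1-δ) (1/2)`, `σ := (θ+1)/2`), and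
  `NbLineBelowOne_of : NbLineBelowOne` concludes the rung BY NAME from the two registered stubs
  (the unique theorem with that conclusion; every other implication into the rung is an `example`
  or concludes the unfolded rung / `NbLine σ`).

LOGICAL POSITION (proved below, given the transfer stub as a hypothesis where needed):
`NbThesis → NbLineBelowOne` (`rung_of_crux`: crux ⇒ RH ⇒ quasi-RH(1/2) ⇒ `NbLine σ` for every
`1/2 < σ < 1`, `nbLine_of_crux`) — the rung is ON PATH below the crux; and, given the easy half at
abscissa `σ` (`EasyHalfAtAbscissa`, Beurling's direction, NOT a registered stub, NOT used by the
skeleton), `NbLine σ → ZeroFreeStrip = Strip.StripZeroFreeStrip` for witnesses `σ ∈ [1/2,1)`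
(`strip_of_nbLine`) — the honest statement that closing this rung at such a witness closes Strip's
crux #2 and conversely (`forall_nbLine_iff_forall_quasiRH`).  Neither stub alone gives the rung; the rung does not give
`NbThesis` or the summit (probes in the harvest folder `bc/`, all FAIL as required).
-/

set_option linter.dupNamespace false

noncomputable section

open MeasureTheory Filter Topology
open scoped Real ENNReal

namespace Summit.RiemannHypothesis.RiemannHypothesis.Cruxes.NbThesis.NbLineBelowOne

open Summit.RiemannHypothesis.RiemannHypothesis.Theses.NymanBeurling
open Literature.NumberTheory.LFunctions

/-! ## The ladder family, the rung, the top -/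

/-- **The σ-ladder of the crux** (gradation P3 of LADDER-NbThesis.md, closure form): the
Nyman–Beurling–Báez-Duarte approximation on the line `Re s = σ` with the pole-killing Cauchy weight
`|s-1|²/|s|⁴` — for every `ε > 0` some Dirichlet polynomial `A(s) = Σ_{n<N} a_n (n+1)^{-s}` has
`∫ |1 - ζ(σ+it) A(σ+it)|² ((σ-1)²+t²)/(σ²+t²)² dt < ε`.  On `Re s = 1/2` the weight is `1/(1/4+t²)`
and `NbLine (1/2) ↔ NbThesis` (`nbLine_half_iff`).  Stated with `∫⁻` (junk-free; the integrand is
continuous).  VERBATIM the harvested `Ladder.NbThesis.NbLine`. [cite: BaezDuarte2003, Thm 1.1 (σ = 1/2); arXiv:2606.16097, Prop 3.1 and Thm 3.1 (general abscissa)] -/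
def NbLine (σ : ℝ) : Prop :=
  ∀ ε : ℝ, 0 < ε → ∃ (N : ℕ) (a : Fin N → ℂ),
    ∫⁻ t : ℝ, ENNReal.ofReal (‖1 - riemannZeta ((σ : ℂ) + t * Complex.I) *
        ∑ n : Fin N, a n * ((n : ℂ) + 1) ^ (-((σ : ℂ) + t * Complex.I))‖ ^ 2 *
        (((σ - 1) ^ 2 + t ^ 2) / (σ ^ 2 + t ^ 2) ^ 2)) < ENNReal.ofReal ε

/-- **The rung** (next rung of the σ-ladder above its proved floor `σ ≥ 1` — `σ > 1` in tree,
`Special.nbLine_of_one_lt`; `σ = 1` in print): the Báez-Duarte approximation holds on SOME line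
strictly left of `Re s = 1`.  Equivalent in print to a zero-free
vertical strip (route Strip's crux #2); RH-implied; open.  VERBATIM the harvested probe statement
`∃ σ : ℝ, σ < 1 ∧ NbLine σ`. [cite: BalazardSaias1998, Théorème NBBF p.311 (floor p = 1 ⟷ σ = 1, Bercovici–Foias 1984 Thm 2.5)] -/
def NbLineBelowOne : Prop :=
  ∃ σ : ℝ, σ < 1 ∧ NbLine σ

/-- **Top of the ladder**: `NbLine (1/2)` is literally the crux `NbThesis` (the weights agree
pointwise on the critical line).  Harvested proof (`Ladder.NbThesis.nbLine_half_iff`). [folklore] -/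
theorem nbLine_half_iff : NbLine (1 / 2) ↔ NbThesis := by
  have e : ((1 / 2 : ℝ) : ℂ) = 1 / 2 := by push_cast; ring
  have key : ∀ t : ℝ,
      (((1 / 2 : ℝ) - 1) ^ 2 + t ^ 2) / ((1 / 2 : ℝ) ^ 2 + t ^ 2) ^ 2 = 1 / (1 / 4 + t ^ 2) := by
    intro t
    have h : (0 : ℝ) < 1 / 4 + t ^ 2 := by positivity
    field_simp
    ring
  simp only [NbLine, NbThesis, e, key, mul_one_div]

/-- The top is the summit: `NbLine (1/2) ↔ Summit.RiemannHypothesis`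
(`nbLine_half_iff` + the landed `Theorems.nbThesis_iff`). [folklore] -/
theorem nbLine_half_iff_riemannHypothesis : NbLine (1 / 2) ↔ Summit.RiemannHypothesis :=
  nbLine_half_iff.trans Theorems.nbThesis_iff

/-! ## The two stub statements -/

/-- **Stub statement (i): a zero-free vertical strip** — `∃ δ > 0` with no zero of `ζ` in
`1 - δ < Re s < 1`.  VERBATIM route Strip's crux #2 `Strip.StripZeroFreeStrip`
(stmt-RiemannHypothesis-10660), SHARED with that route. [cite: Titchmarsh1986, §6.19 and ch. 14 (status: open since 1896)] -/
def ZeroFreeStrip : Prop :=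
  ∃ δ : ℝ, 0 < δ ∧ ∀ s : ℂ, riemannZeta s = 0 → 1 - δ < s.re → s.re < 1 → False

/-- `ZeroFreeStrip` IS route Strip's crux #2, by `Iff.rfl`. [folklore] -/
theorem zeroFreeStrip_iff_strip :
    ZeroFreeStrip ↔ Summit.RiemannHypothesis.RiemannHypothesis.Theses.Strip.StripZeroFreeStrip :=
  Iff.rfl

/-- `ZeroFreeStrip` in the Literature vocabulary: `∃ δ > 0, QuasiRiemannHypothesis (1 - δ)`,
by `Iff.rfl`. [folklore] -/
theorem zeroFreeStrip_iff_quasiRH :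
    ZeroFreeStrip ↔ ∃ δ : ℝ, 0 < δ ∧ QuasiRiemannHypothesis (1 - δ) :=
  Iff.rfl

/-- **Stub statement (ii): the deep half of Báez-Duarte's criterion at abscissa `σ`** — quasi-RH
with abscissa `θ ∈ [1/2, 1)` gives the weighted `L²` approximation on every line `Re s = σ`,
`θ < σ < 1`.  An UNCONDITIONAL implication (folklore; the critical-line case `θ = σ = 1/2` with a
`δ`-shift is Báez-Duarte 2003 §2.2, in tree as `baezDuarte_dirichlet_onlyIf_holds`; here `σ > θ`
leaves room for the Perron shift, so no `δ`-shift and no functional equation are needed). [cite: BaezDuarte2003, §2.2 (architecture); Titchmarsh1986, Thm 14.2 and §14.25 (quasi-RH bounds for ζ^{±1}, Perron shift)] -/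
def DeepHalfAtAbscissa : Prop :=
  ∀ θ σ : ℝ, 1 / 2 ≤ θ → θ < σ → σ < 1 → QuasiRiemannHypothesis θ → NbLine σ

/-! ## Registered stubs -/

/-- Registered stub (i): the zero-free strip (= `Strip.StripZeroFreeStrip`, shared). [cite: Titchmarsh1986, §6.19 (open problem)] -/
theorem stub_zeroFreeStrip : ZeroFreeStrip := by
  sorry

/-- Registered stub (ii): the transfer quasi-RH(θ) ⇒ `NbLine σ` for `θ < σ < 1`. [cite: BaezDuarte2003, §2.2] -/
theorem stub_deepHalfAtAbscissa : DeepHalfAtAbscissa := by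
  sorry

/-! ## Composition (kernel-checked) -/

/-- **The two stubs give the rung**: from a zero-free strip of width `δ` take
`θ := max (1 - δ) (1/2)` (quasi-RH(`θ`) holds) and `σ := (θ + 1)/2 < 1`; the transfer gives
`NbLine σ`.  Stated on the UNFOLDED rung so that `NbLineBelowOne_of` below is the unique theorem
concluding the rung declaration by name (the shape `ledger skeleton check` audits). [folklore] -/
theorem nbLineBelowOne_of_stubs :
    ZeroFreeStrip → DeepHalfAtAbscissa → ∃ σ : ℝ, σ < 1 ∧ NbLine σ := by
  rintro ⟨δ, hδ, hstrip⟩ hdeep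
  have hQ : QuasiRiemannHypothesis (max (1 - δ) (1 / 2)) := fun s hs h0 h1 =>
    hstrip s hs (lt_of_le_of_lt (le_max_left _ _) h0) h1
  have hθ1 : max (1 - δ) (1 / 2) < 1 := max_lt (by linarith) (by norm_num)
  exact ⟨(max (1 - δ) (1 / 2) + 1) / 2, by linarith,
    hdeep (max (1 - δ) (1 / 2)) _ (le_max_right _ _) (by linarith) (by linarith) hQ⟩

/-- **The line concludes the rung BY NAME from the registered stubs** — the unique theorem of this
file whose conclusion is the rung declaration (the shape `ledger skeleton check` audits). [folklore] -/
theorem NbLineBelowOne_of : NbLineBelowOne :=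
  nbLineBelowOne_of_stubs stub_zeroFreeStrip stub_deepHalfAtAbscissa

example : ZeroFreeStrip → DeepHalfAtAbscissa → NbLineBelowOne := nbLineBelowOne_of_stubs

/-! ## Logical position: the crux implies the rung (on path), given the transfer -/

/-- RH gives quasi-RH at every abscissa `θ ≥ 1/2` (in-tree `quasiRiemannHypothesis_one_half_iff_holds`
and monotonicity). [folklore] -/
theorem quasiRH_of_riemannHypothesis (h : Summit.RiemannHypothesis) {θ : ℝ} (hθ : 1 / 2 ≤ θ) :
    QuasiRiemannHypothesis θ :=
  (quasiRiemannHypothesis_one_half_iff_holds.mpr h).mono hθ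

/-- **Crux ⇒ every rung of the open regime** (given the transfer stub): `NbThesis` ⇒ RH
(`Theorems.nbThesis_iff`) ⇒ quasi-RH(1/2) ⇒ `NbLine σ` for every `1/2 < σ < 1`. [folklore] -/
theorem nbLine_of_crux (hdeep : DeepHalfAtAbscissa) (hX : NbThesis) {σ : ℝ} (h₁ : 1 / 2 < σ)
    (h₂ : σ < 1) : NbLine σ :=
  hdeep (1 / 2) σ le_rfl h₁ h₂ (quasiRH_of_riemannHypothesis (Theorems.nbThesis_iff.mp hX) le_rfl)

/-- **Crux ⇒ rung** (on path), given the transfer stub; stated on the unfolded rung so that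
`NbLineBelowOne_of` stays the unique theorem concluding the rung by name. [folklore] -/
theorem rung_of_crux (hdeep : DeepHalfAtAbscissa) (hX : NbThesis) : ∃ σ : ℝ, σ < 1 ∧ NbLine σ :=
  ⟨3 / 4, by norm_num, nbLine_of_crux hdeep hX (by norm_num) (by norm_num)⟩

example (hdeep : DeepHalfAtAbscissa) (hX : NbThesis) : NbLineBelowOne := rung_of_crux hdeep hX

example (hdeep : DeepHalfAtAbscissa) (h : Summit.RiemannHypothesis) : NbLineBelowOne :=
  rung_of_crux hdeep (Theorems.nbThesis_iff.mpr h)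

/-! ## The converse positioning: the rung is Strip's crux #2 in Nyman–Beurling clothing -/

/-- **The easy (Beurling) half at abscissa `σ`** — NOT a registered stub and NOT used by the
skeleton: the approximation on `Re s = σ` excludes zeros of `ζ` with `Re ρ > σ` (point evaluation
at `ρ` of the `H²(Re s > σ)` function `(1 - ζA)(s-1)/s²`, which equals `(ρ-1)/ρ² ≠ 0` at a zero;
the tree has the `σ = 1/2` case, `riemannHypothesis_of_dirichlet_approx` /
`Theorems.nbIntegrand_floor_of_zero`, by a contour argument that transfers line by line). [cite: arXiv:2606.16097, Prop 3.1; Beurling1955 (easy half)] -/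
def EasyHalfAtAbscissa : Prop :=
  ∀ σ : ℝ, 1 / 2 ≤ σ → σ < 1 → NbLine σ → QuasiRiemannHypothesis σ

/-- Given the easy half, a rung witnessed at an abscissa `σ ∈ [1/2, 1)` yields route Strip's
zero-free strip of width `1 - σ`. (`NbLine` is not known to be monotone in `σ` without the two
halves, so the converse is stated for witnesses in `[1/2, 1)`; for `σ < 1/2` the statement
`NbLine σ` is expected to be FALSE by the same easy half and the critical-line zeros.) [folklore] -/
theorem strip_of_nbLine (heasy : EasyHalfAtAbscissa) {σ : ℝ} (h₁ : 1 / 2 ≤ σ) (h₂ : σ < 1)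
    (h : NbLine σ) : ZeroFreeStrip :=
  ⟨1 - σ, by linarith, fun s hs h0 h1 => heasy σ h₁ h₂ h s hs (by linarith) h1⟩

/-- The same, concluding route Strip's crux #2 by its own name. -/
example (heasy : EasyHalfAtAbscissa) {σ : ℝ} (h₁ : 1 / 2 ≤ σ) (h₂ : σ < 1) (h : NbLine σ) :
    Summit.RiemannHypothesis.RiemannHypothesis.Theses.Strip.StripZeroFreeStrip :=
  zeroFreeStrip_iff_strip.mp (strip_of_nbLine heasy h₁ h₂ h)

/-- **Both halves make the σ-rungs and the zero-free strips the same ladder**: for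
`1/2 ≤ θ < 1`, (`NbLine` at every abscissa in `(θ,1)`) ↔ (quasi-RH at every abscissa in `(θ,1)`).
This is the precise sense in which the rung is route Strip's crux in costume. [folklore] -/
theorem forall_nbLine_iff_forall_quasiRH (hdeep : DeepHalfAtAbscissa) (heasy : EasyHalfAtAbscissa)
    {θ : ℝ} (hθ : 1 / 2 ≤ θ) :
    (∀ σ : ℝ, θ < σ → σ < 1 → NbLine σ) ↔ (∀ σ : ℝ, θ < σ → σ < 1 → QuasiRiemannHypothesis σ) := by
  constructor
  · intro h σ h₁ h₂
    exact heasy σ (by linarith) h₂ (h σ h₁ h₂)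
  · intro h σ h₁ h₂
    have hmid : QuasiRiemannHypothesis ((θ + σ) / 2) := h _ (by linarith) (by linarith)
    exact hdeep ((θ + σ) / 2) σ (by linarith) (by linarith) h₂ hmid

end Summit.RiemannHypothesis.RiemannHypothesis.Cruxes.NbThesis.NbLineBelowOne

end
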